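/-
Copyright (c) 2026 the pub-hodgecm-mathlib formalisation cell (harness21).  Prover seat hodgecm-mathlib-K2E4-p11 (g7): Track B «K2-LIT»,
#184♮ = hLiu418 = stmt-HodgeConjecture-24832; socket #41 open surface (u-0c) — file I4, EDITION 2 as a NEW file: the continuity letter `hMIDc` of ★ p861839
`exists_middleTerm_package` DISCHARGED (desk K2E5-p17 (g8) 16:18:26Z «ED. 2 = hMIDc ✓ go»).  THEOREMS ONLY (no `def`, no `instance`, no `notation`, no named-fact hypothesis, no `sorry`).
-/
import Summits.HodgeConjecture.HodgeConjecture.Theorems.K2LiuSiegelEisensteinMiddleTermPackageInstance   -- ★ p861839 (this seat): `exists_middleTerm_package` (I4 skeleton)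
import Summits.HodgeConjecture.HodgeConjecture.Theorems.K2LiuSiegelEisensteinMajorantCompact            -- ★ G1-END (K2Liu-p13 lineage): `exists_summable_majorant_on_compact'`
import Summits.HodgeConjecture.HodgeConjecture.Theorems.K2LiuFourierCoeffDeltaContinuous               -- ★ p861715 (F0P2-p11): `continuous_integral_wt_smul_conj_mul` (dominated convergence on a compact weight)
import Literature.NumberTheory.Automorphic.IdeleGroupBorel                                       -- ★ `borelSpace_ideleGroup`, `exists_isHaarMeasure_ideleGroup`
import Literature.NumberTheory.Automorphic.AdelicSecondCountable                                  -- ★ `secondCountableTopology_adeleRing`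
import Literature.NumberTheory.Automorphic.MixedSpaceUnitsHaar                                    -- ★ `mixedUnitsHaar` + `IsHaarMeasure`
import HarnessLib

/-!
# Crux `HLiu418`, socket #41, (u-0c) FILE I4 ED. 2 — `K2LiuSiegelEisensteinMiddleTermContinuous`: THE UN-NORMALISED MIDDLE TERM IS CONTINUOUS IN `h`
# (`hMIDc` paid) and the middle-cell package with only the I1∕I2∕I3 letters, the section letters and the carrier letters visible

Cell `hodgecm-mathlib`, crux item hLiu418 = `stmt-HodgeConjecture-24832`; squad K2 ∕ K2Liu, road `K2_Liu`, socket #41; LEAD F0P6-plan (g14) BATCH #51 (1), desk K2E5-p17 (g8)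
16:18:26Z (END-CONDITIONS (a)–(c)).  Lane `--supports stmt-HodgeConjecture-24832 --as helper` (count-neutral helper; closes no socket by itself).

THE MATHEMATICS [MoeglinWaldspurger1995, II.1.5, II.1.7], [Garrett2018, §3.10], [Folland1995, §2.3].  For `χ` unitary, `n∕2 < re s` and a continuous Siegel section `f_s`, the
orbit sum `x ↦ Σ'_{q ∈ REST} f_s(γ_q · x)` over the complement of the identity and the unipotent Weyl orbits converges uniformly on compact subsets of `H(𝔸)` (★ G1-END
`exists_summable_majorant_on_compact'`: a summable majorant of `q ↦ f_s(γ_q x)` uniform in `x ∈ K′` compact), hence is CONTINUOUS (`continuousOn_tsum` on a compact neighbourhood;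
`H(𝔸)` is locally compact) — §1; integrating against a measurable weight `β ≤ 𝟙_K` supported in a compact `K ⊆ N_Δ(𝔸)` for a measure finite on compacts keeps continuity in the
translation variable `h` (★ p861715 `continuous_integral_wt_smul_conj_mul` at the trivial character, ★ `unipDeltaChar_zero`) — §2 = the letter `hMIDc` of ★ I4; §3 = ★ I4
`exists_middleTerm_package` with `hMIDc` discharged AND (END-CONDITIONS (a), (b)) the idele class domain `𝓕`, the Haar measures `ν μ μinf` and the Borel letters of `𝔸_L`
constructed inside the proof (★ `borelSpace_ideleGroup`, ★ `exists_isIdeleClassDomain`, ★ `exists_isHaarMeasure_ideleGroup`, `Measure.addHaar`, ★ `mixedUnitsHaar` — the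
conclusion mentions none of them): visible letters are the I1∕I2∕I3 packages (`W…`, `φ…`, `mx…`, `γ hγ`, `c₀ hMID`, `S γl hγ0 hγ1`), the section letters `χ hχ f hfΔ hfc`, and the
carrier letters (`νN` finite on compacts, `β` measurable, `β ≤ 𝟙_K`, `K` compact — all in END-CONDITION (c)'s list).
HONEST LABEL.  Count-neutral helper; it retires nothing by itself: `HC_CM` is proved only modulo the 7 printed citations (2 remaining named inputs:
hLiu418 = `stmt-HodgeConjecture-24832`, h413 = `stmt-HodgeConjecture-24833`) until rung 0 closes.

## References
* [MoeglinWaldspurger1995] C. Mœglin, J.-L. Waldspurger, *Spectral decomposition and Eisenstein series* (1995), II.1.5, II.1.7, IV.1.9.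
* [Garrett2018] P. Garrett, *Modern analysis of automorphic forms by example* (2018), §3.10.   * [Folland1995] G. Folland, *A course in abstract harmonic analysis* (1995), §2.3.
* [Tan1999] V. Tan, Canad. J. Math. 51 (1999), §4 Prop. 4.8.
-/

set_option autoImplicit false
set_option linter.dupNamespace false -- the mandated namespace repeats `HodgeConjecture.HodgeConjecture`

noncomputable section

open MeasureTheory Measure NumberField NumberField.mixedEmbedding IsDedekindDomain Set Filter Topology Metric
open scoped NNReal ENNReal Matrix BigOperators ComplexConjugate
open Literature.NumberTheory.Automorphic
open Literature.NumberTheory.GaloisRepresentations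
open Literature.NumberTheory.GelbartRogawski1991 Literature.NumberTheory.GelbartRogawski1991.GRConstruction
open Literature.NumberTheory.K2Lit.SiegelDoubled
open Summit.HodgeConjecture.HodgeConjecture.Cruxes.HLiu418.K2LiuGL2FlatSectionFiniteData (ofFinite_mem)
open Summit.HodgeConjecture.HodgeConjecture.Cruxes.HLiu418.K2LiuSiegelUnipotentFourierDefs
open Summit.HodgeConjecture.HodgeConjecture.Cruxes.HLiu418.K2LiuSiegelEisensteinMajorantCompact (exists_summable_majorant_on_compact')
open Summit.HodgeConjecture.HodgeConjecture.Cruxes.HLiu418.K2LiuFourierCoeffDeltaContinuous (continuous_integral_wt_smul_conj_mul)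
open Summit.HodgeConjecture.HodgeConjecture.Cruxes.HLiu418.K2LiuSiegelEisensteinMiddleTermPackageInstance (exists_middleTerm_package)

namespace Summit.HodgeConjecture.HodgeConjecture.Cruxes.HLiu418.K2LiuSiegelEisensteinMiddleTermContinuous

variable (L : Type) [Field L] [NumberField L] [IsCMField L] {N M n : ℕ} (e : Fin N × Fin M ≃ Fin n)
  (dV : Fin N → L) (hdV : ∀ i, IsCMField.complexConj L (dV i) = dV i)
  (dW : Fin M → L) (hdW : ∀ i, IsCMField.complexConj L (dW i) = dW i)
variable [MeasurableSpace (unipDelta L e dV hdV dW hdW)] [BorelSpace (unipDelta L e dV hdV dW hdW)]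

/-! ## §1 The orbit sum over `REST` is continuous on `H(𝔸)` -/

omit [MeasurableSpace (unipDelta L e dV hdV dW hdW)] [BorelSpace (unipDelta L e dV hdV dW hdW)] in
/-- **`x ↦ Σ'_{q ∈ REST} f_s(γ_q · x)` IS CONTINUOUS** (`χ` unitary, `n∕2 < re s`, `f_s` a continuous Siegel section): uniform convergence on a compact neighbourhood of each point
(★ G1-END `exists_summable_majorant_on_compact'`, `continuousOn_tsum`; `H(𝔸)` locally compact). [cite: MoeglinWaldspurger1995, II.1.5] [cite: Garrett2018, §3.10] -/
theorem continuous_tsum_rest (hdV0 : ∀ i, dV i ≠ 0) (hdW0 : ∀ i, dW i ≠ 0)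
    {χ : HeckeCharacter L} (hχ : χ.IsUnitary) {s : ℂ} (hs : (n : ℝ) / 2 < s.re)
    {f : ℂ → HA L e dV hdV dW hdW → ℂ} (hfΔ : IsSiegelDeltaSection L e dV hdV dW hdW χ s (f s)) (hfc : Continuous (f s))
    (wq : unipDeltaRat L e dV hdV dW hdW → ratH L e dV hdV dW hdW) :
    Continuous fun x : HA L e dV hdV dW hdW =>
      (∑' q : ↥(({Quotient.mk (MulAction.orbitRel (siegelDeltaRat L e dV hdV dW hdW) (ratH L e dV hdV dW hdW)) 1} ∪
            Set.range (fun ν : unipDeltaRat L e dV hdV dW hdW =>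
              (Quotient.mk (MulAction.orbitRel (siegelDeltaRat L e dV hdV dW hdW) (ratH L e dV hdV dW hdW)) (wq ν) :
                SiegelDeltaQuot L e dV hdV dW hdW)))ᶜ : Set (SiegelDeltaQuot L e dV hdV dW hdW)),
          f s ((((Quotient.out (q : SiegelDeltaQuot L e dV hdV dW hdW) : ratH L e dV hdV dW hdW) : HA L e dV hdV dW hdW)) *
            x)) := by
  refine continuous_iff_continuousAt.2 fun x₀ => ?_
  obtain ⟨C, hCc, hCn⟩ := exists_compact_mem_nhds x₀
  obtain ⟨u₀, hu₀, hb⟩ := exists_summable_majorant_on_compact' L e dV hdV hdV0 dW hdW hdW0 hχ hs hfΔ hfc hCc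
  refine ContinuousOn.continuousAt ?_ hCn
  refine continuousOn_tsum (fun q => ?_) (hu₀.subtype _) (fun q x hx => hb x hx q.1)
  exact (hfc.comp (continuous_const.mul continuous_id)).continuousOn

/-! ## §2 The letter `hMIDc`: the un-normalised middle term is continuous in `h` -/

/-- **THE UN-NORMALISED MIDDLE TERM `h ↦ ∫ β(u) • Σ'_{q ∈ REST} f_s(γ_q·(u·h)) dνN(u)` IS CONTINUOUS** for `n∕2 < re s` — ★ p861715 `continuous_integral_wt_smul_conj_mul` at the trivial
character (`ψ_0 ≡ 1`, ★ `unipDeltaChar_zero`) with `φ :=` §1's orbit sum: the letter `hMIDc` of ★ I4 `exists_middleTerm_package`.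
[cite: MoeglinWaldspurger1995, II.1.7] [cite: Folland1995, §2.3] -/
theorem continuous_middleTerm (hdV0 : ∀ i, dV i ≠ 0) (hdW0 : ∀ i, dW i ≠ 0)
    (νN : Measure (unipDelta L e dV hdV dW hdW)) [IsFiniteMeasureOnCompacts νN]
    {β : unipDelta L e dV hdV dW hdW → ℝ≥0∞} (hβm : Measurable β) {K : Set (unipDelta L e dV hdV dW hdW)} (hK : IsCompact K) (hβK : ∀ u, β u ≤ K.indicator 1 u)
    {χ : HeckeCharacter L} (hχ : χ.IsUnitary) {s : ℂ} (hs : (n : ℝ) / 2 < s.re)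
    {f : ℂ → HA L e dV hdV dW hdW → ℂ} (hfΔ : IsSiegelDeltaSection L e dV hdV dW hdW χ s (f s)) (hfc : Continuous (f s))
    (wq : unipDeltaRat L e dV hdV dW hdW → ratH L e dV hdV dW hdW) :
    Continuous fun h : HA L e dV hdV dW hdW => ∫ u, (β u).toReal •
        (∑' q : ↥(({Quotient.mk (MulAction.orbitRel (siegelDeltaRat L e dV hdV dW hdW) (ratH L e dV hdV dW hdW)) 1} ∪
            Set.range (fun ν : unipDeltaRat L e dV hdV dW hdW =>
              (Quotient.mk (MulAction.orbitRel (siegelDeltaRat L e dV hdV dW hdW) (ratH L e dV hdV dW hdW)) (wq ν) :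
                SiegelDeltaQuot L e dV hdV dW hdW)))ᶜ : Set (SiegelDeltaQuot L e dV hdV dW hdW)),
          f s ((((Quotient.out (q : SiegelDeltaQuot L e dV hdV dW hdW) : ratH L e dV hdV dW hdW) : HA L e dV hdV dW hdW)) *
            ((u : HA L e dV hdV dW hdW) * h))) ∂νN := by
  have h := continuous_integral_wt_smul_conj_mul L e dV hdV dW hdW νN 0 (continuous_tsum_rest L e dV hdV dW hdW hdV0 hdW0 hχ hs hfΔ hfc wq) hβm hK hβK
  refine h.congr fun x => ?_
  refine integral_congr_ae (Filter.Eventually.of_forall fun u => ?_)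
  simp only [unipDeltaChar_zero, Circle.coe_one, map_one, one_mul]

/-! ## §3 ★ I4 with `hMIDc` discharged -/

/-- **(u-0c) I4, ED. 2 — THE MIDDLE-CELL TERM PACKAGE WITH `hMIDc`, `𝓕`, `ν μ μinf` AND THE BOREL LETTERS OF `𝔸_L` PAID**: ★ `exists_middleTerm_package` with its continuity
letter supplied by §2 on `n∕2 < re s`, the idele class domain by ★ `exists_isIdeleClassDomain` under ★ `borelSpace_ideleGroup`, and the three Haar measures constructed
(★ `exists_isHaarMeasure_ideleGroup`, `Measure.addHaar` on `𝔸_L²`, ★ `mixedUnitsHaar`) over `borel 𝔸_L` — legitimate because the conclusion mentions none of them; new visible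
letters instead: `χ hχ`, `hfΔ : ∀ s, f_s ∈ I_Δ(s,χ)`, `hfc`, and the carrier letters (`νN` finite on compacts, `β` measurable, `β ≤ 𝟙_K`, `K` compact).
[cite: MoeglinWaldspurger1995, II.1.7, IV.1.9] [cite: Tan1999, §4 Prop. 4.8] [cite: CogdellAnalyticTheory2004, §2.3 Thm. 2.2] -/
theorem exists_middleTerm_package' (hn : n = 2) (hdV0 : ∀ i, dV i ≠ 0) (hdW0 : ∀ i, dW i ≠ 0)
    (S : Finset (HeightOneSpectrum (𝓞 L))) (γl : ∀ v : HeightOneSpectrum (𝓞 L), ValuativeRel.ValueGroupWithZero (v.adicCompletion L))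
    (hγ0 : ∀ v ∈ S, γl v ≠ 0) (hγ1 : ∀ v ∈ S, γl v < 1)
    (W : Submodule ℂ (↥(standardMaximalCompactGL 2 L) → ℂ)) [FiniteDimensional ℂ W]
    (hWstab : ∀ B ∈ W, ∀ k₀ : ↥(standardMaximalCompactGL 2 L), (fun k => B (k * k₀)) ∈ W)
    (hWlaw : ∀ B ∈ W, ∀ p k : ↥(standardMaximalCompactGL 2 L),
    ((p : GL (Fin 2) (AdeleRing (𝓞 L) L)) : Matrix (Fin 2) (Fin 2) (AdeleRing (𝓞 L) L)) 1 0 = 0 → B (p * k) = B k)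
    (hWlev : ∀ B ∈ W, ∀ (k : ↥(standardMaximalCompactGL 2 L)) (r : GL (Fin 2) (FiniteAdeleRing (𝓞 L) L)) (hr : r ∈ glFiniteIntegralLevel 2 L),
    (∀ v ∈ S, GLn.evalAt 2 L v r ∈ congruenceGL 2 (γl v)) →
      B ⟨(k : GL (Fin 2) (AdeleRing (𝓞 L) L)) * GLn.ofFinite 2 L r, (standardMaximalCompactGL 2 L).mul_mem k.2 (ofFinite_mem hr)⟩ = B k)
    (hWcont : ∀ B ∈ W, Continuous B)
    (hWext : ∀ B ∈ W, ∃ bB : ℂ → GL (Fin 2) (AdeleRing (𝓞 L) L) → ℂ,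
    (∀ s : ℂ, 0 < s.re → ∀ (d : Fin 2 → (AdeleRing (𝓞 L) L)ˣ) (g : GL (Fin 2) (AdeleRing (𝓞 L) L)),
      bB s (glDiagonal 2 (AdeleRing (𝓞 L) L) d * g) =
        ((IdeleClassGroup.ideleNorm L (d 0) : ℝ) : ℂ) ^ (s + 1 / 2) * ((IdeleClassGroup.ideleNorm L (d 1) : ℝ) : ℂ) ^ (-(s + 1 / 2)) * bB s g) ∧
    (∀ s : ℂ, 0 < s.re → ∀ u g : GL (Fin 2) (AdeleRing (𝓞 L) L), (u : Matrix (Fin 2) (Fin 2) (AdeleRing (𝓞 L) L)) 1 0 = 0 →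
      (u : Matrix (Fin 2) (Fin 2) (AdeleRing (𝓞 L) L)) 0 0 = 1 → (u : Matrix (Fin 2) (Fin 2) (AdeleRing (𝓞 L) L)) 1 1 = 1 → bB s (u * g) = bB s g) ∧
    (∀ s : ℂ, 0 < s.re → ∀ (k : GL (Fin 2) (AdeleRing (𝓞 L) L)) (hk : k ∈ standardMaximalCompactGL 2 L), bB s k = B ⟨k, hk⟩))
    (φ : ℂ → HA L e dV hdV dW hdW → GL (Fin 2) (AdeleRing (𝓞 L) L) → ℂ)
    (hφT : ∀ (s : ℂ) (x : HA L e dV hdV dW hdW), 0 < s.re → ∀ (d : Fin 2 → (AdeleRing (𝓞 L) L)ˣ) (g : GL (Fin 2) (AdeleRing (𝓞 L) L)),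
    φ s x (glDiagonal 2 (AdeleRing (𝓞 L) L) d * g) =
      ((IdeleClassGroup.ideleNorm L (d 0) : ℝ) : ℂ) ^ (s + 1 / 2) * ((IdeleClassGroup.ideleNorm L (d 1) : ℝ) : ℂ) ^ (-(s + 1 / 2)) * φ s x g)
    (hφN : ∀ (s : ℂ) (x : HA L e dV hdV dW hdW), 0 < s.re → ∀ u g : GL (Fin 2) (AdeleRing (𝓞 L) L), (u : Matrix (Fin 2) (Fin 2) (AdeleRing (𝓞 L) L)) 1 0 = 0 →
    (u : Matrix (Fin 2) (Fin 2) (AdeleRing (𝓞 L) L)) 0 0 = 1 → (u : Matrix (Fin 2) (Fin 2) (AdeleRing (𝓞 L) L)) 1 1 = 1 → φ s x (u * g) = φ s x g)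
    (hφW : ∀ (s : ℂ) (x : HA L e dV hdV dW hdW), 0 < s.re → (fun k : ↥(standardMaximalCompactGL 2 L) => φ s x k) ∈ W)
    (hφhol : ∀ (x : HA L e dV hdV dW hdW) (k : ↥(standardMaximalCompactGL 2 L)), DifferentiableOn ℂ (fun s => φ s x k) {s : ℂ | 0 < s.re})
    (hφbd : ∀ z : ℂ, 0 < z.re → ∃ C A r : ℝ, 0 ≤ C ∧ 0 ≤ A ∧ 0 < r ∧ ∀ s : ℂ, dist s z < r →
    ∀ (x : HA L e dV hdV dW hdW) (k : ↥(standardMaximalCompactGL 2 L)), ‖φ s x k‖ ≤ C * adelicHeightGL (n + n) L (x : GL (Fin (n + n)) (AdeleRing (𝓞 L) L)) ^ A)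
    (mx : HA L e dV hdV dW hdW → GL (Fin 2) (AdeleRing (𝓞 L) L)) {C₀ A₀ : ℝ} (hC₀ : 0 ≤ C₀) (hA₀ : 0 ≤ A₀)
    (hmx : ∀ x : HA L e dV hdV dW hdW, adelicHeightGL 2 L (mx x) ≤ C₀ * adelicHeightGL (n + n) L (x : GL (Fin (n + n)) (AdeleRing (𝓞 L) L)) ^ A₀)
    (γ : Projectivization L (Fin 2 → L) → GL (Fin 2) L)
    (hγ : ∀ p, ∃ cL : L, cL ≠ 0 ∧ (Pi.single 1 1 : Fin 2 → L) ᵥ* (γ p : Matrix (Fin 2) (Fin 2) L) = cL • p.rep)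
    (νN : Measure (unipDelta L e dV hdV dW hdW)) (β : unipDelta L e dV hdV dW hdW → ℝ≥0∞)
    (wq : unipDeltaRat L e dV hdV dW hdW → ratH L e dV hdV dW hdW)
    {χ : HeckeCharacter L} (hχ : χ.IsUnitary) (f : ℂ → HA L e dV hdV dW hdW → ℂ)
    (hfΔ : ∀ s : ℂ, IsSiegelDeltaSection L e dV hdV dW hdW χ s (f s)) (hfc : ∀ s : ℂ, Continuous (f s))
    [IsFiniteMeasureOnCompacts νN] (hβm : Measurable β)
    {K : Set (unipDelta L e dV hdV dW hdW)} (hK : IsCompact K) (hβK : ∀ u, β u ≤ K.indicator 1 u)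
    (c₀ : ℂ)
    (hMID : ∀ (s : ℂ) (h : HA L e dV hdV dW hdW), (n : ℝ) / 2 < s.re →
      (∫ u, (β u).toReal •
        (∑' q : ↥(({Quotient.mk (MulAction.orbitRel (siegelDeltaRat L e dV hdV dW hdW) (ratH L e dV hdV dW hdW)) 1} ∪
            Set.range (fun ν : unipDeltaRat L e dV hdV dW hdW =>
              (Quotient.mk (MulAction.orbitRel (siegelDeltaRat L e dV hdV dW hdW) (ratH L e dV hdV dW hdW)) (wq ν) :
                SiegelDeltaQuot L e dV hdV dW hdW)))ᶜ : Set (SiegelDeltaQuot L e dV hdV dW hdW)),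
          f s ((((Quotient.out (q : SiegelDeltaQuot L e dV hdV dW hdW) : ratH L e dV hdV dW hdW) : HA L e dV hdV dW hdW)) *
            ((u : HA L e dV hdV dW hdW) * h))) ∂νN) =
        c₀ * ∑' p : Projectivization L (Fin 2 → L), φ s h (Matrix.GeneralLinearGroup.map (algebraMap L (AdeleRing (𝓞 L) L)) (γ p) * mx h)) :
    ∃ E₇ : ℂ → HA L e dV hdV dW hdW → ℂ,
      (∀ h : HA L e dV hdV dW hdW, DifferentiableOn ℂ (fun s => E₇ s h) {s : ℂ | 0 < s.re}) ∧
      (∀ s : ℂ, 0 < s.re → Continuous (E₇ s)) ∧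
      (∀ (s : ℂ) (h : HA L e dV hdV dW hdW), (n : ℝ) / 2 < s.re →
        E₇ s h = (∏ p ∈ ({(1 / 2 : ℂ)} : Finset ℂ), (s - p)) * ∫ u, (β u).toReal •
        (∑' q : ↥(({Quotient.mk (MulAction.orbitRel (siegelDeltaRat L e dV hdV dW hdW) (ratH L e dV hdV dW hdW)) 1} ∪
            Set.range (fun ν : unipDeltaRat L e dV hdV dW hdW =>
              (Quotient.mk (MulAction.orbitRel (siegelDeltaRat L e dV hdV dW hdW) (ratH L e dV hdV dW hdW)) (wq ν) :
                SiegelDeltaQuot L e dV hdV dW hdW)))ᶜ : Set (SiegelDeltaQuot L e dV hdV dW hdW)),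
          f s ((((Quotient.out (q : SiegelDeltaQuot L e dV hdV dW hdW) : ratH L e dV hdV dW hdW) : HA L e dV hdV dW hdW)) *
            ((u : HA L e dV hdV dW hdW) * h))) ∂νN) ∧
      (∀ z : ℂ, 0 < z.re → ∃ C A r : ℝ, 0 < r ∧ ∀ s : ℂ, dist s z < r → ∀ h : HA L e dV hdV dW hdW,
        ‖E₇ s h‖ ≤ C * adelicHeightGL (n + n) L (h : GL (Fin (n + n)) (AdeleRing (𝓞 L) L)) ^ A) := by
  -- END-CONDITIONS (a)+(b) (desk K2E5-p17 16:18:26Z): the Borel σ-algebra of `𝔸_L`, the three Haar measures and the idele class domain are CONSTRUCTED here — none of them is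
  -- mentioned by the conclusion (★ `borelSpace_ideleGroup`, ★ `exists_isIdeleClassDomain`, ★ `exists_isHaarMeasure_ideleGroup`, Mathlib `Measure.addHaar` on `𝔸_L²` under
  -- ★ `secondCountableTopology_adeleRing` ∕ ★ `locallyCompactSpace_adeleRing'`, ★ `mixedUnitsHaar`).
  letI : MeasurableSpace (AdeleRing (𝓞 L) L) := borel _
  haveI : BorelSpace (AdeleRing (𝓞 L) L) := ⟨rfl⟩
  haveI := borelSpace_ideleGroup L
  haveI := secondCountableTopology_adeleRing L
  haveI := locallyCompactSpace_adeleRing' L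
  obtain ⟨𝓕, h𝓕⟩ := exists_isIdeleClassDomain L
  obtain ⟨ν, hν⟩ := exists_isHaarMeasure_ideleGroup (K := L)
  refine exists_middleTerm_package L e dV hdV dW hdW hn ν (Measure.addHaar : Measure (Fin 2 → AdeleRing (𝓞 L) L)) (mixedUnitsHaar L) S γl hγ0 hγ1 W hWstab hWlaw hWlev
    hWcont hWext φ hφT hφN hφW hφhol hφbd mx hC₀ hA₀ hmx γ hγ νN β wq f h𝓕 c₀ hMID (fun s hs => ?_)
  exact continuous_middleTerm L e dV hdV dW hdW hdV0 hdW0 νN hβm hK hβK hχ hs (hfΔ s) (hfc s) wq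

end Summit.HodgeConjecture.HodgeConjecture.Cruxes.HLiu418.K2LiuSiegelEisensteinMiddleTermContinuous

end
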